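import Literature.NumberTheory.Automorphic.UnitaryGroupTruncatedKernelClassIntegrableOfSiegelTwo
import Literature.NumberTheory.Automorphic.UnitaryGroupSiegelConjLevelDepthTwo
import HarnessLib

/-!
# LAW 1 of the H-side, per class: every truncated class kernel `k^T_𝔬` of `U(J₂)` is integrable on
# `G(F)∖G(𝔸_F)` for `T` large — HYPOTHESIS-FREE at the CM pair (the `N = 2` twin of
# ★ `UnitaryGroupTruncatedKernelClassIntegrableHolds`)
(Arthur, *A trace formula for reductive groups I*, Duke Math. J. 45 (1978), Thm. 7.1; Rogawski, *Automorphic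
Representations of Unitary Groups in Three Variables* (1990), §2.2 p. 13: «Furthermore, `k^T_𝔬` is integrable
over `𝐙G\𝐆`», with «`G = U(3)`, `U(2)`, or `U(2) × U(1)`», p. 98.)

Topic `NumberTheory/Automorphic`; namespace `Literature.NumberTheory.Automorphic.UnitaryGroup`. THEOREMS ONLY
(no definition, no named fact, no instance, no notation, no `sorry`). H-side copy of LAWS 1–5 for
`H = U(Φ₂) × U(Φ₁)` (hodgecm-mathlib, F0P3a LEAD WORD #123∕#124; census `CENSUS-LAWS-Hside` §3 LAW 1, «class rows
first»; desk TABLE #1 row (H-L1-cusp)). The last step of the LAW 1 chain at `N = 2`: the Siegel closer ★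
`truncatedKernelClassIntegrable_of_levelDepth_two` ∕ `…_cm_of_levelDepth_two`
(`UnitaryGroupTruncatedKernelClassIntegrableOfSiegelTwo`) left ONE hypothesis, the level depth `hdepth` of the
dilated line domains on the Siegel set; it is EXACTLY the head ★ `exists_rational_borel_forall_valuation_conj_le_two`
of `UnitaryGroupSiegelConjLevelDepthTwo` (B-p14 (g26): the rational dilation `β = d(ι m)` making `π(b⁻¹ub)`
`𝔫`-divisible off the diagonal at the finite places for `b ∈ S`, `u ∈ β⁻¹ n(𝓕⁻) β`). Plugging it in:

* `truncatedKernelClassIntegrable_of_unimodular_iwasawa_two` — generic quadratic `E/F` (`c² = 1`, `c ≠ 1`,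
  `[E:F] = 2`), unimodularity of `U(J₂)(𝔸_F)` and the adelic Iwasawa decomposition `hBK` as the only hypotheses;
* **`truncatedKernelClassIntegrable_cm_two`** — at the CM pair `(L⁺, L, complexConj)`, NO HYPOTHESIS beyond the
  two class-map axioms ★ `IsConjInvariant` ∕ ★ `IsUnipotentInvariantOnBorel`: for every Haar measure `ν` of
  `N(𝔸)`, fundamental domain `𝓕` of `N(F)`, automorphic measure `μ`, test function `f` and class `𝔬` there is `T₀`
  with `[g] ↦ k^T_𝔬(g⁻¹)` `μ`-integrable for all `T > T₀` — Arthur's Theorem 7.1 ∕ Rogawski's «`k^T_𝔬` is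
  integrable» for the quasi-split `U(2)` of a CM field, the socket the LAW 2∕3 class rows and the LAW 4 fold of
  the H-side read BY NAME (F0P3a-p06 (g6)'s `ArthurTraceOfClassMapTwo`).

HC_CM is proved only modulo the 7 printed citations until rung 0 closes.

## References

* J. Arthur, *A trace formula for reductive groups I*, Duke Math. J. 45 (1978), Thm. 7.1, §8 (pp. 947–950)
  [Arthur1978TraceFormulaI].
* J. D. Rogawski, *Automorphic Representations of Unitary Groups in Three Variables*, Ann. of Math. Stud.
  123 (1990), §2.2 (p. 13), §7.3 (p. 98) [Rogawski1990].
-/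

set_option autoImplicit false

noncomputable section

open MeasureTheory Measure NumberField IsDedekindDomain Set
open scoped NNReal ENNReal Pointwise MatrixGroups

namespace Literature.NumberTheory.Automorphic

namespace UnitaryGroup

variable {F E : Type} [Field F] [NumberField F] [Field E] [NumberField E] [Algebra F E]
  {c : E ≃ₐ[F] E} {ι : Type*}

/-- **EVERY `k^T_𝔬` OF `U(J₂)` IS INTEGRABLE, from unimodularity and the Iwasawa decomposition** (generic quadratic
`E/F` with `c² = 1`, `c ≠ 1`, `[E:F] = 2`): the Siegel closer ★ `truncatedKernelClassIntegrable_of_levelDepth_two` with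
its `hdepth` discharged by ★ `exists_rational_borel_forall_valuation_conj_le_two`.
[cite: Arthur1978TraceFormulaI, Thm. 7.1] [cite: Rogawski1990, §2.2 (p. 13)] -/
theorem truncatedKernelClassIntegrable_of_unimodular_iwasawa_two (hc : c * c = 1) (hc1 : c ≠ 1)
    (h2 : Module.finrank F E = 2)
    (hunimod : ∀ [MeasurableSpace (quasiSplit F E c 2).Adelic] [BorelSpace (quasiSplit F E c 2).Adelic]
      (νG : Measure (quasiSplit F E c 2).Adelic), νG.IsHaarMeasure → νG.IsMulRightInvariant)
    (hBK : ∀ g : (quasiSplit F E c 2).Adelic, ∃ b ∈ borelAdelic F E c 2, ∃ k : (quasiSplit F E c 2).Adelic,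
      adelicVal F E c 2 ((StdForm.antidiagonal 2).over E) k ∈ standardMaximalCompactGL 2 E ∧ g = b * k)
    {cl : (quasiSplit F E c 2).arithmeticSubgroup → ι} (hcl : IsConjInvariant cl)
    (hclN : IsUnipotentInvariantOnBorel F E c 2 cl) :
    ∀ [MeasurableSpace (adelicUnipotent F E c 2)] [BorelSpace (adelicUnipotent F E c 2)]
      (ν : Measure (adelicUnipotent F E c 2)) [ν.IsHaarMeasure]
      (𝓕 : Set (adelicUnipotent F E c 2)),
      IsFundamentalDomain (rationalUnipotent F E c 2) 𝓕 ν →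
        ∀ (μ : Measure (quasiSplit F E c 2).automorphicQuotient)
          [(quasiSplit F E c 2).IsAutomorphicMeasure μ]
          (f : (quasiSplit F E c 2).Adelic → ℂ), IsQuasiSplitTest F E c 2 f →
          ∀ i : ι, ∃ T₀ : ℝ≥0, ∀ T : ℝ≥0, T₀ < T →
            Integrable ((quasiSplit F E c 2).quotFun (truncatedKernelClass ν 𝓕 T cl i f)) μ :=
  truncatedKernelClassIntegrable_of_levelDepth_two hc hc1 h2 hunimod hBK hcl hclN
    (fun hΩ _ hW hSTt hexp _ h𝔫 => exists_rational_borel_forall_valuation_conj_le_two hc hΩ hW hSTt hexp h𝔫)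

/-- **EVERY `k^T_𝔬` IS INTEGRABLE, at the CM pair `(L⁺, L, complexConj)` on `U(J₂)`** — Arthur's Theorem 7.1 ∕
Rogawski's «`k^T_𝔬` is integrable over `G(F)\G(𝔸_F)`» for the quasi-split `U(J₂)` attached to a CM field `L`, for
EVERY conjugation-invariant `N(F)`-saturated class map `cl : G(F) → ι` (e.g. the characteristic-polynomial classes):
for every Haar measure `ν` of `N(𝔸)`, fundamental domain `𝓕` of `N(F)`, automorphic measure `μ`, test function `f`
and class `𝔬` there is `T₀` with `[g] ↦ k^T_𝔬(g⁻¹)` `μ`-integrable for all `T > T₀`. NO HYPOTHESIS beyond the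
class-map axioms (`c² = 1`, `c ≠ 1`, `[L:L⁺] = 2`, unimodularity ★ H-B2, Iwasawa ★ `_cm`, level depth ★ (R6b-ii) all
discharged). [cite: Arthur1978TraceFormulaI, Thm. 7.1] [cite: Rogawski1990, §2.2 (p. 13)] -/
theorem truncatedKernelClassIntegrable_cm_two (L : Type) [Field L] [NumberField L] [IsCMField L]
    {cl : (quasiSplit (↥(maximalRealSubfield L)) L (IsCMField.complexConj L) 2).arithmeticSubgroup → ι}
    (hcl : IsConjInvariant cl)
    (hclN : IsUnipotentInvariantOnBorel (↥(maximalRealSubfield L)) L (IsCMField.complexConj L) 2 cl) :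
    ∀ [MeasurableSpace (adelicUnipotent (↥(maximalRealSubfield L)) L (IsCMField.complexConj L) 2)]
      [BorelSpace (adelicUnipotent (↥(maximalRealSubfield L)) L (IsCMField.complexConj L) 2)]
      (ν : Measure (adelicUnipotent (↥(maximalRealSubfield L)) L (IsCMField.complexConj L) 2)) [ν.IsHaarMeasure]
      (𝓕 : Set (adelicUnipotent (↥(maximalRealSubfield L)) L (IsCMField.complexConj L) 2)),
      IsFundamentalDomain (rationalUnipotent (↥(maximalRealSubfield L)) L (IsCMField.complexConj L) 2) 𝓕 ν →
        ∀ (μ : Measure (quasiSplit (↥(maximalRealSubfield L)) L (IsCMField.complexConj L) 2).automorphicQuotient)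
          [(quasiSplit (↥(maximalRealSubfield L)) L (IsCMField.complexConj L) 2).IsAutomorphicMeasure μ]
          (f : (quasiSplit (↥(maximalRealSubfield L)) L (IsCMField.complexConj L) 2).Adelic → ℂ),
          IsQuasiSplitTest (↥(maximalRealSubfield L)) L (IsCMField.complexConj L) 2 f →
          ∀ i : ι, ∃ T₀ : ℝ≥0, ∀ T : ℝ≥0, T₀ < T →
            Integrable ((quasiSplit (↥(maximalRealSubfield L)) L (IsCMField.complexConj L) 2).quotFun
              (truncatedKernelClass ν 𝓕 T cl i f)) μ :=
  truncatedKernelClassIntegrable_cm_of_levelDepth_two L hcl hclN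
    (fun hΩ _ hW hSTt hexp _ h𝔫 =>
      exists_rational_borel_forall_valuation_conj_le_two (complexConj_mul_complexConj L) hΩ hW hSTt hexp h𝔫)

end UnitaryGroup

end Literature.NumberTheory.Automorphic
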